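import Mathlib.Analysis.SpecialFunctions.ExpDeriv
import Mathlib.Analysis.SpecialFunctions.Sqrt
import Mathlib.Analysis.SpecialFunctions.Pow.Real
import Mathlib.Analysis.Calculus.Deriv.Inv
import Mathlib.Analysis.Calculus.Deriv.Comp
import Mathlib.Analysis.Calculus.Deriv.Mul
import HarnessLib

/-!
# The profile and the constants of the swirl barrier (one-variable calculus and algebra)

Cell `ns-blowup`, seat `ns-blowup-ecbridge-2` (g13; the E–C endpoint theory seat). Proof file
(elementary real analysis; NO definitions, no named facts, no `sorry`). Inputs of
`SwirlTypeIBarrier.lean` («Type-I inflow forces Type-I swirl»): in the similarity variable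
`s = |x − c|/√(T − t)` the swirl `Γ = r u_θ` of an axisymmetric Navier–Stokes flow is compared
with the barrier `Φ = K Ψ_a(s) + A s²`, `Ψ_a(s) = (1 − e^{−as})/a`, `a = (C + 1)/ν`. Writing
`μ = 1/√(T − t)` and the barrier slice as a function of `σ = |x − c|²`,
`G(σ) = K Ψ_a(μ√σ) + Aμ²σ`, this file provides (all profiles written out explicitly — no `def`):

* the profile `Ψ_a`: `Ψ_a' = e^{−as}` (`hasDerivAt_swirlProfile`), monotonicity, `Ψ_a ≥ 0` on
  `[0, ∞)`, the concavity bound `s e^{−as} ≤ Ψ_a(s)` and `Ψ_a(s) ≤ s`;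
* the first two `σ`-derivatives of `G` on `(0, ∞)` (`hasDerivAt_swirlBarrierSq`,
  `hasDerivAt_swirlBarrierSq₁`) and the values at `σ = ρ²` of `2G'(ρ²)` and of
  `4G''(ρ²)ρ² + 6G'(ρ²)` (the three-dimensional Laplacian of `x ↦ G(|x − c|²)`);
* THE SUPERSOLUTION INEQUALITY `swirlBarrier_bracket_nonpos`: with `S₀ = 2C + 2ν + 2`,
  `P₀ = 2ν + (2C+1)S₀`, `A = τF₀`, `K ≥ e^{aS₀}AP₀`, for `s ≥ 0`, `μ > 0`, `τμ³ ≥ 1`: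
  `−K e^{−as}(1 + s/2) + A(2ν + 2Cs − s²) + sF₀/μ³ ≤ 0` (for `s ≥ S₀` the polynomial is
  nonpositive, for `s ≤ S₀` the exponential is at least `e^{−aS₀}`), and the algebraic identity
  `swirlBarrier_interior_identity` reducing the interior differential inequality to it;
* `exists_swirlBarrierK`: a constant `K ≥ 0` meeting the interior condition `e^{aS₀}AP₀ ≤ K`,
  the initial condition `V₀ ≤ Kμ₀e^{−aμ₀ρ₀}` and the lateral condition `C_Γ ≤ Kμ₀ρ₀e^{−aμ₀ρ₀}`
  (`μ₀ = 1/√D`, `D = T − t₀`), namely `K = e^{aS₀}AP₀ + e^{aρ₀/√D}√D(V₀ + C_Γ/ρ₀) + 1`.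

WHAT THIS IS NOT: not Navier–Stokes evidence — calculus lemmas for a comparison argument about
the uninhabited type `ClayBlowup ν` (consumer `ClayBlowupLocalMeridionalTypeI.lean`).

References (for the equation being compared against): G. Koch, N. Nadirashvili, G. Seregin,
V. Šverák, Acta Math. 203 (2009), §1 (1.8)–(1.9) [cite: KochNadirashviliSereginSverak2009, §1 (1.8)–(1.9)];
G. M. Lieberman, *Second order parabolic differential equations* (1996), Ch. II
[cite: Lieberman1996, Ch. II Lemma 2.1].
-/

noncomputable section

open Set Filter Topology

namespace Summit.NavierStokesRegularity.FluidComputer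

/-! ### The profile `Ψ_a(s) = (1 − e^{−as})/a` -/

section Profile

/-- `Ψ_a'(s) = e^{−as}` for `Ψ_a(s) = (1 − e^{−as})/a` (`a ≠ 0`). [folklore] -/
theorem hasDerivAt_swirlProfile {a : ℝ} (ha : a ≠ 0) (s : ℝ) :
    HasDerivAt (fun s : ℝ => (1 - Real.exp (-(a * s))) / a) (Real.exp (-(a * s))) s := by
  have h1 : HasDerivAt (fun s : ℝ => -(a * s)) (-a) s := by
    have h := ((hasDerivAt_id s).const_mul a).neg
    have e : (-fun y : ℝ => a * id y) = fun s : ℝ => -(a * s) := by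
      funext y; simp
    rw [e, mul_one] at h
    exact h
  have h2 : HasDerivAt (fun s : ℝ => (1 - Real.exp (-(a * s))) / a)
      ((0 - Real.exp (-(a * s)) * (-a)) / a) s :=
    ((hasDerivAt_const s (1 : ℝ)).sub h1.exp).div_const a
  have e : (0 - Real.exp (-(a * s)) * (-a)) / a = Real.exp (-(a * s)) := by
    field_simp
    ring
  rw [e] at h2
  exact h2

/-- `Ψ_a ≥ 0` on `[0, ∞)` (`a > 0`). [folklore] -/
theorem swirlProfile_nonneg {a : ℝ} (ha : 0 < a) {s : ℝ} (hs : 0 ≤ s) :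
    0 ≤ (1 - Real.exp (-(a * s))) / a := by
  refine div_nonneg ?_ ha.le
  have : Real.exp (-(a * s)) ≤ 1 := Real.exp_le_one_iff.2 (by nlinarith)
  linarith

/-- `Ψ_a` is non-decreasing (`a > 0`). [folklore] -/
theorem swirlProfile_mono {a : ℝ} (ha : 0 < a) {s s' : ℝ} (h : s ≤ s') :
    (1 - Real.exp (-(a * s))) / a ≤ (1 - Real.exp (-(a * s'))) / a := by
  refine div_le_div_of_nonneg_right ?_ ha.le
  have : Real.exp (-(a * s')) ≤ Real.exp (-(a * s)) := Real.exp_le_exp.2 (by nlinarith)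
  linarith

/-- **Concavity bound** `s e^{−as} ≤ Ψ_a(s)` (`a > 0`; i.e. `1 + as ≤ e^{as}`): the barrier
dominates a LINEAR function of the distance near its centre. [folklore] -/
theorem mul_exp_le_swirlProfile {a : ℝ} (ha : 0 < a) (s : ℝ) :
    s * Real.exp (-(a * s)) ≤ (1 - Real.exp (-(a * s))) / a := by
  rw [le_div_iff₀ ha]
  have h1 : a * s + 1 ≤ Real.exp (a * s) := Real.add_one_le_exp _
  have h2 : Real.exp (-(a * s)) * Real.exp (a * s) = 1 := by
    rw [← Real.exp_add]; simp
  have h3 : 0 < Real.exp (-(a * s)) := Real.exp_pos _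
  nlinarith

/-- `Ψ_a(s) ≤ s` (`a > 0`; i.e. `1 − as ≤ e^{−as}`). [folklore] -/
theorem swirlProfile_le_self {a : ℝ} (ha : 0 < a) (s : ℝ) :
    (1 - Real.exp (-(a * s))) / a ≤ s := by
  rw [div_le_iff₀ ha]
  have h1 : -(a * s) + 1 ≤ Real.exp (-(a * s)) := Real.add_one_le_exp _
  linarith

end Profile

/-! ### The barrier slice `G(σ) = K Ψ_a(μ√σ) + A μ² σ` and its `σ`-derivatives -/

section Barrier

/-- `G'(σ) = K e^{−aμ√σ} μ/(2√σ) + Aμ²` on `(0, ∞)` for `G(σ) = K Ψ_a(μ√σ) + Aμ²σ`. [folklore] -/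
theorem hasDerivAt_swirlBarrierSq (K A : ℝ) {a : ℝ} (μ : ℝ) (ha : a ≠ 0) {σ : ℝ} (hσ : 0 < σ) :
    HasDerivAt
      (fun σ : ℝ => K * ((1 - Real.exp (-(a * (μ * Real.sqrt σ)))) / a) + A * μ ^ 2 * σ)
      (K * (Real.exp (-(a * (μ * Real.sqrt σ))) * (μ / (2 * Real.sqrt σ))) + A * μ ^ 2) σ := by
  have hsq : HasDerivAt (fun σ : ℝ => μ * Real.sqrt σ) (μ * (1 / (2 * Real.sqrt σ))) σ :=
    (Real.hasDerivAt_sqrt hσ.ne').const_mul μ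
  have h1 := (hasDerivAt_swirlProfile ha (μ * Real.sqrt σ)).comp σ hsq
  have h2 : HasDerivAt (fun σ : ℝ => A * μ ^ 2 * σ) (A * μ ^ 2 * 1) σ :=
    (hasDerivAt_id σ).const_mul (A * μ ^ 2)
  have h := (h1.const_mul K).add h2
  refine (h.congr_of_eventuallyEq (Eventually.of_forall fun y => ?_)).congr_deriv ?_
  · simp only [Function.comp_apply, Pi.add_apply]
  · ring

/-- `G''(σ) = −(Kμ/4) e^{−aμ√σ}(aμ/σ + 1/(σ√σ))` on `(0, ∞)`. [folklore] -/
theorem hasDerivAt_swirlBarrierSq₁ (K A a μ : ℝ) {σ : ℝ} (hσ : 0 < σ) :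
    HasDerivAt
      (fun σ : ℝ => K * (Real.exp (-(a * (μ * Real.sqrt σ))) * (μ / (2 * Real.sqrt σ))) + A * μ ^ 2)
      (-(K * μ / 4) * Real.exp (-(a * (μ * Real.sqrt σ))) * (a * μ / σ + 1 / (σ * Real.sqrt σ)))
      σ := by
  have hr0 : 0 < Real.sqrt σ := Real.sqrt_pos.2 hσ
  have hrr : Real.sqrt σ * Real.sqrt σ = σ := Real.mul_self_sqrt hσ.le
  have hsq : HasDerivAt (fun σ : ℝ => Real.sqrt σ) (1 / (2 * Real.sqrt σ)) σ :=
    Real.hasDerivAt_sqrt hσ.ne'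
  have hlin : HasDerivAt (fun σ : ℝ => -(a * (μ * Real.sqrt σ)))
      (-(a * (μ * (1 / (2 * Real.sqrt σ))))) σ := by
    have h := ((hsq.const_mul μ).const_mul a).neg
    have e : (-fun y : ℝ => a * (μ * Real.sqrt y)) = fun σ : ℝ => -(a * (μ * Real.sqrt σ)) := by
      funext y; simp
    rw [e] at h
    exact h
  have hexp := hlin.exp
  have hinv : HasDerivAt (fun σ : ℝ => μ / (2 * Real.sqrt σ))
      ((0 * (2 * Real.sqrt σ) - μ * (2 * (1 / (2 * Real.sqrt σ)))) / (2 * Real.sqrt σ) ^ 2) σ :=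
    (hasDerivAt_const σ μ).div (hsq.const_mul 2) (by positivity)
  have h := ((hexp.mul hinv).const_mul K).add (hasDerivAt_const σ (A * μ ^ 2))
  refine (h.congr_of_eventuallyEq (Eventually.of_forall fun y => ?_)).congr_deriv ?_
  · simp only [Pi.add_apply, Pi.mul_apply]
  · set r : ℝ := Real.sqrt σ with hr_def
    have hσr : σ = r * r := hrr.symm
    rw [hσr]
    field_simp
    ring

/-- `2 G'(ρ²) = K μ e^{−aμρ}/ρ + 2Aμ²` for `ρ > 0`. [folklore] -/
theorem two_mul_swirlBarrierSq₁_sq (K A a μ : ℝ) {ρ : ℝ} (hρ : 0 < ρ) :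
    2 * (K * (Real.exp (-(a * (μ * Real.sqrt (ρ ^ 2)))) * (μ / (2 * Real.sqrt (ρ ^ 2)))) + A * μ ^ 2) =
      K * μ * Real.exp (-(a * (μ * ρ))) / ρ + 2 * A * μ ^ 2 := by
  simp only [Real.sqrt_sq hρ.le]
  field_simp

/-- `4 G''(ρ²) ρ² + 6 G'(ρ²) = −K a μ² e^{−aμρ} + 2 K μ e^{−aμρ}/ρ + 6 A μ²` for `ρ > 0`: the value
of the three-dimensional Laplacian of the barrier slice (`laplacian_comp_norm_sq`). [folklore] -/
theorem laplacian_value_swirlBarrierSq (K A a μ : ℝ) {ρ : ℝ} (hρ : 0 < ρ) :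
    4 * (-(K * μ / 4) * Real.exp (-(a * (μ * Real.sqrt (ρ ^ 2)))) *
          (a * μ / ρ ^ 2 + 1 / (ρ ^ 2 * Real.sqrt (ρ ^ 2)))) * ρ ^ 2 +
        6 * (K * (Real.exp (-(a * (μ * Real.sqrt (ρ ^ 2)))) * (μ / (2 * Real.sqrt (ρ ^ 2)))) +
          A * μ ^ 2) =
      -(K * a * μ ^ 2 * Real.exp (-(a * (μ * ρ)))) +
        2 * K * μ * Real.exp (-(a * (μ * ρ))) / ρ + 6 * A * μ ^ 2 := by
  simp only [Real.sqrt_sq hρ.le]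
  field_simp
  ring

end Barrier

/-! ### The supersolution inequality and the interior identity (pure algebra) -/

section Algebra

/-- **The supersolution inequality in the similarity variable.** With `a = (C+1)/ν`,
`S₀ = 2C + 2ν + 2`, `P₀ = 2ν + (2C+1)S₀`, `A = τF₀` and any `K ≥ e^{aS₀}AP₀` (`K ≥ 0`), for
`s ≥ 0` and `μ > 0` with `1 ≤ τμ³`: `−K e^{−as}(1 + s/2) + A(2ν + 2Cs − s²) + sF₀/μ³ ≤ 0`.
[folklore] -/
theorem swirlBarrier_bracket_nonpos {ν C F₀ τ K μ s : ℝ} (hν : 0 < ν) (hC : 0 ≤ C)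
    (hF₀ : 0 ≤ F₀) (hτ : 0 ≤ τ) (hμ : 0 < μ) (hμτ : 1 ≤ τ * μ ^ 3) (hs : 0 ≤ s)
    (hK0 : 0 ≤ K)
    (hK : Real.exp ((C + 1) / ν * (2 * C + 2 * ν + 2)) * (τ * F₀) *
        (2 * ν + (2 * C + 1) * (2 * C + 2 * ν + 2)) ≤ K) :
    -(K * Real.exp (-((C + 1) / ν * s)) * (1 + s / 2)) +
        τ * F₀ * (2 * ν + 2 * C * s - s ^ 2) + s * F₀ / μ ^ 3 ≤ 0 := by
  set a : ℝ := (C + 1) / ν with ha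
  set S₀ : ℝ := 2 * C + 2 * ν + 2 with hS₀
  set A : ℝ := τ * F₀ with hA
  have ha0 : 0 < a := by rw [ha]; positivity
  have hA0 : 0 ≤ A := by rw [hA]; positivity
  have he0 : 0 < Real.exp (-(a * s)) := Real.exp_pos _
  have hforce : s * F₀ / μ ^ 3 ≤ s * A := by
    rw [div_le_iff₀ (by positivity), hA]
    have : s * F₀ * 1 ≤ s * F₀ * (τ * μ ^ 3) :=
      mul_le_mul_of_nonneg_left hμτ (by positivity)
    nlinarith
  have hKe : 0 ≤ K * Real.exp (-(a * s)) * (1 + s / 2) := by positivity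
  by_cases hsS : S₀ ≤ s
  · have hpoly : 2 * ν + 2 * C * s - s ^ 2 + s ≤ 0 := by nlinarith
    have h1 : A * (2 * ν + 2 * C * s - s ^ 2) + s * A ≤ 0 := by nlinarith
    linarith
  · push Not at hsS
    have hpoly : 2 * ν + 2 * C * s - s ^ 2 + s ≤ 2 * ν + (2 * C + 1) * S₀ := by nlinarith
    have hexp : Real.exp (-(a * S₀)) ≤ Real.exp (-(a * s)) :=
      Real.exp_le_exp.2 (by nlinarith)
    have hKS : A * (2 * ν + (2 * C + 1) * S₀) ≤ K * Real.exp (-(a * S₀)) := by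
      have h1 : Real.exp (a * S₀) * A * (2 * ν + (2 * C + 1) * S₀) * Real.exp (-(a * S₀)) ≤
          K * Real.exp (-(a * S₀)) :=
        mul_le_mul_of_nonneg_right hK (Real.exp_pos _).le
      have h2 : Real.exp (a * S₀) * Real.exp (-(a * S₀)) = 1 := by
        rw [← Real.exp_add]; simp
      have h3 : Real.exp (a * S₀) * A * (2 * ν + (2 * C + 1) * S₀) * Real.exp (-(a * S₀)) =
          A * (2 * ν + (2 * C + 1) * S₀) := by
        rw [show Real.exp (a * S₀) * A * (2 * ν + (2 * C + 1) * S₀) * Real.exp (-(a * S₀)) =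
          (Real.exp (a * S₀) * Real.exp (-(a * S₀))) * (A * (2 * ν + (2 * C + 1) * S₀)) by ring,
          h2, one_mul]
      linarith
    have h3 : K * Real.exp (-(a * S₀)) ≤ K * Real.exp (-(a * s)) * (1 + s / 2) := by
      have h4 : K * Real.exp (-(a * S₀)) ≤ K * Real.exp (-(a * s)) :=
        mul_le_mul_of_nonneg_left hexp hK0
      have h5 : K * Real.exp (-(a * s)) * 1 ≤ K * Real.exp (-(a * s)) * (1 + s / 2) :=
        mul_le_mul_of_nonneg_left (by linarith) (by positivity)
      linarith
    have h6 : A * (2 * ν + 2 * C * s - s ^ 2) + s * A ≤ A * (2 * ν + (2 * C + 1) * S₀) := by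
      nlinarith
    linarith

/-- **The interior identity**: with `a = (C+1)/ν`, `g₁ = (Kμe/ρ + 2Aμ²)/2` (`= G'(ρ²)`) and
`L = −Kaμ²e + 2Kμe/ρ + 6Aμ²` (`= ΔΦ`),
`νL − 4νg₁ + 2g₁Cρμ + ρF₀ − (Keρμ³/2 + Aμ⁴ρ²) = μ²·[−Ke(1 + s/2) + A(2ν + 2Cs − s²) + sF₀/μ³]`,
`s = μρ`. [folklore] -/
theorem swirlBarrier_interior_identity {ν C K A μ ρ e F₀ : ℝ} (hν : ν ≠ 0) (hρ : ρ ≠ 0)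
    (hμ : μ ≠ 0) :
    ν * (-(K * ((C + 1) / ν) * μ ^ 2 * e) + 2 * K * μ * e / ρ + 6 * A * μ ^ 2) -
          4 * ν * ((K * μ * e / ρ + 2 * A * μ ^ 2) / 2) +
        2 * ((K * μ * e / ρ + 2 * A * μ ^ 2) / 2) * (C * ρ * μ) + ρ * F₀ -
      (K * e * ρ * μ ^ 3 / 2 + A * μ ^ 4 * ρ ^ 2) =
    μ ^ 2 * (-(K * e * (1 + μ * ρ / 2)) + A * (2 * ν + 2 * C * (μ * ρ) - (μ * ρ) ^ 2) +
      μ * ρ * F₀ / μ ^ 3) := by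
  field_simp
  ring

/-- **The constant `K` of the swirl barrier.** For `ν > 0`, `C, C_Γ, V₀, F₀ ≥ 0`, `ρ₀, D > 0`
there is `K ≥ 0` (namely `e^{aS₀}AP₀ + e^{aρ₀/√D}√D(V₀ + C_Γ/ρ₀) + 1`, `a = (C+1)/ν`,
`A = D√D F₀`) with: (i) the interior condition `e^{aS₀}AP₀ ≤ K` of
`swirlBarrier_bracket_nonpos`; (ii) the initial condition `V₀ ≤ Kμ₀e^{−aμ₀ρ₀}`; (iii) the lateral
condition `C_Γ ≤ Kμ₀ρ₀e^{−aμ₀ρ₀}`, `μ₀ = 1/√D`. [folklore] -/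
theorem exists_swirlBarrierK {ν C CΓ V₀ F₀ ρ₀ D : ℝ} (hν : 0 < ν) (hC : 0 ≤ C) (hCΓ : 0 ≤ CΓ)
    (hV₀ : 0 ≤ V₀) (hF₀ : 0 ≤ F₀) (hρ₀ : 0 < ρ₀) (hD : 0 < D) :
    ∃ K : ℝ, 0 ≤ K ∧
      Real.exp ((C + 1) / ν * (2 * C + 2 * ν + 2)) * (D * Real.sqrt D * F₀) *
          (2 * ν + (2 * C + 1) * (2 * C + 2 * ν + 2)) ≤ K ∧
      V₀ ≤ K * (Real.sqrt D)⁻¹ * Real.exp (-((C + 1) / ν * ((Real.sqrt D)⁻¹ * ρ₀))) ∧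
      CΓ ≤ K * ((Real.sqrt D)⁻¹ * ρ₀ * Real.exp (-((C + 1) / ν * ((Real.sqrt D)⁻¹ * ρ₀)))) := by
  set a : ℝ := (C + 1) / ν with ha
  have hsD : 0 < Real.sqrt D := Real.sqrt_pos.2 hD
  set E₁ : ℝ := Real.exp (a * (ρ₀ / Real.sqrt D)) with hE₁
  set E₂ : ℝ := Real.exp (-(a * ((Real.sqrt D)⁻¹ * ρ₀))) with hE₂
  set K₁ : ℝ := Real.exp (a * (2 * C + 2 * ν + 2)) * (D * Real.sqrt D * F₀) *
    (2 * ν + (2 * C + 1) * (2 * C + 2 * ν + 2)) with hK₁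
  have hK₁0 : 0 ≤ K₁ := by rw [hK₁]; positivity
  have hE : E₁ * E₂ = 1 := by
    rw [hE₁, hE₂, ← Real.exp_add, inv_mul_eq_div]; simp
  refine ⟨K₁ + E₁ * Real.sqrt D * (V₀ + CΓ / ρ₀) + 1, by positivity, ?_, ?_, ?_⟩
  · have : 0 ≤ E₁ * Real.sqrt D * (V₀ + CΓ / ρ₀) := by positivity
    linarith
  · set K : ℝ := K₁ + E₁ * Real.sqrt D * (V₀ + CΓ / ρ₀) + 1 with hK
    have hV : E₁ * Real.sqrt D * V₀ ≤ K := by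
      have : 0 ≤ E₁ * Real.sqrt D * (CΓ / ρ₀) := by positivity
      have hsplit : E₁ * Real.sqrt D * (V₀ + CΓ / ρ₀) =
          E₁ * Real.sqrt D * V₀ + E₁ * Real.sqrt D * (CΓ / ρ₀) := by ring
      linarith
    have h6 := mul_le_mul_of_nonneg_right hV (by positivity : 0 ≤ (Real.sqrt D)⁻¹ * E₂)
    have h7 : E₁ * Real.sqrt D * V₀ * ((Real.sqrt D)⁻¹ * E₂) = V₀ := by
      calc E₁ * Real.sqrt D * V₀ * ((Real.sqrt D)⁻¹ * E₂)
          = (E₁ * E₂) * (Real.sqrt D * (Real.sqrt D)⁻¹) * V₀ := by ring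
        _ = V₀ := by rw [hE, mul_inv_cancel₀ hsD.ne', one_mul, one_mul]
    rw [h7] at h6
    linarith
  · set K : ℝ := K₁ + E₁ * Real.sqrt D * (V₀ + CΓ / ρ₀) + 1 with hK
    have hΓ : E₁ * Real.sqrt D * (CΓ / ρ₀) ≤ K := by
      have : 0 ≤ E₁ * Real.sqrt D * V₀ := by positivity
      have hsplit : E₁ * Real.sqrt D * (V₀ + CΓ / ρ₀) =
          E₁ * Real.sqrt D * V₀ + E₁ * Real.sqrt D * (CΓ / ρ₀) := by ring
      linarith
    have h6 := mul_le_mul_of_nonneg_right hΓ (by positivity : 0 ≤ (Real.sqrt D)⁻¹ * ρ₀ * E₂)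
    have h7 : E₁ * Real.sqrt D * (CΓ / ρ₀) * ((Real.sqrt D)⁻¹ * ρ₀ * E₂) = CΓ := by
      calc E₁ * Real.sqrt D * (CΓ / ρ₀) * ((Real.sqrt D)⁻¹ * ρ₀ * E₂)
          = (E₁ * E₂) * ((Real.sqrt D * (Real.sqrt D)⁻¹) * (CΓ / ρ₀ * ρ₀)) := by ring
        _ = CΓ := by
            rw [hE, one_mul, mul_inv_cancel₀ hsD.ne', one_mul, div_mul_cancel₀ _ hρ₀.ne']
    rw [h7] at h6
    linarith

end Algebra

end Summit.NavierStokesRegularity.FluidComputer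

end
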